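import Literature.Analysis.FluidPDE.ESSFarFieldVorticityHalfSpaceTopCurl
import Literature.Analysis.FluidPDE.GKPRigidityBackwardUniqueness
import HarnessLib

/-!
# The far-field backward-uniqueness step on a half-space from the vanishing of the FINAL VORTICITY,
# general frame (Escauriaza–Seregin–Šverák 2003, §3 (3.31)–(3.32), Thm. 5.1)

Analysis/FluidPDE proof file (theorems only: no definition, no named fact, no `sorry`).

`farField_curl_eq_zero_halfSpace_of_vorticity_top_of_frame` — the vorticity-level normal-form
theorem `farField_curl_eq_zero_halfSpace_of_vorticity_top`
(`ESSFarFieldVorticityHalfSpaceTopCurl.lean`: viscosity `1`, window `]-1, 0[`) transported by the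
Navier–Stokes rescaling `Φ(s, y) = (T₁ + βs, γy)`, `β = T₁ - T₄`, `γ = √(νβ)`, word for word as
the tree's `farField_curl_eq_zero_halfSpace_of_frame` transports the velocity-level theorem
(the vorticity rescales with the extra factor `γ`: `∇ ∧ U'(s, ·)(y) = αγ (∇ ∧ U)(T₁ + βs, ·)(γy)`):
if `(U, p)` solves the Navier–Stokes system (viscosity `ν`, no force) in
`𝒟'((T₄, T₁) × {⟪x, d⟫ > R})` with `C^∞` slices, jointly continuous `D_xⁿU` (`n ≤ 4`) and
`‖D_xⁿU‖ ≤ K` (`n ≤ 3`) there, and its VORTICITY agrees a.e. there with a field `ω'` whose slices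
tend to `0` weakly as `t ↑ T₁`, then `∇ ∧ U(t, ·) = 0` on `{⟪x, d⟫ > R + √(ν (T₁ - T₄))}` for every
`t ∈ (T₄, T₁)`.

Consumer: backward uniqueness for local Leray solutions from an IRROTATIONAL half-space of the
final value; the rotational final datum of Type-I dissipation-law blow-up profiles.

## References

* L. Escauriaza, G. Seregin, V. Šverák, Russ. Math. Surveys 58:2 (2003) 211–250, §3
  (3.31)–(3.32) and Thm. 5.1. [`EscauriazaSereginSverak2003`]
* I. Gallagher, G. Koch, F. Planchon, Comm. Math. Phys. 343 (2016), §2.5 (the frame of the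
  ball version). [`GKP2016`]
-/

noncomputable section

open MeasureTheory TopologicalSpace Set Function Filter Metric
open _root_.Topology
open scoped ENNReal NNReal InnerProductSpace RealInnerProductSpace SchwartzMap

namespace Literature.Analysis.FluidPDE

set_option maxHeartbeats 800000 in
/-- **The far-field vorticity vanishes on a half-space when it vanishes there at the final time,
general frame** (Escauriaza–Seregin–Šverák 2003, §3 (3.31)–(3.32) with Thm. 5.1). Let `‖d‖ = 1`,
`ν > 0`, `T₄ < T₁`, and on `Ω = (T₄, T₁) × {⟪x, d⟫ > R}` let `(U, p)` solve the Navier–Stokes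
system (viscosity `ν`, no force) in the sense of distributions, with `C^∞` slices at the points of
`Ω`, jointly continuous spatial derivatives `D_xⁿU`, `n ≤ 4`, and `‖D_xⁿU‖ ≤ K` on `Ω` for `n ≤ 3`;
let `ω' = ∇ ∧ U` a.e. on `Ω` have slices tending to zero weakly as `t ↑ T₁`. Then
`∇ ∧ U(t, ·) = 0` at every point of `{⟪x, d⟫ > R + √(ν (T₁ - T₄))}`, for every `t ∈ (T₄, T₁)`.
Word for word the tree's `farField_curl_eq_zero_halfSpace_of_frame`, feeding the vorticity-level
normal form. [cite: EscauriazaSereginSverak2003, §3 (3.31)-(3.32) and Thm. 5.1] -/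
theorem farField_curl_eq_zero_halfSpace_of_vorticity_top_of_frame {d : EuclideanSpace ℝ (Fin 3)}
    (hd : ‖d‖ = 1) {ν T₄ T₁ R K : ℝ} (hν : 0 < ν) (hT₄ : T₄ < T₁)
    {ω' U : ℝ → EuclideanSpace ℝ (Fin 3) → EuclideanSpace ℝ (Fin 3)}
    {p : ℝ → EuclideanSpace ℝ (Fin 3) → ℝ}
    (hfinal : ∀ φ : EuclideanSpace ℝ (Fin 3) → EuclideanSpace ℝ (Fin 3),
      FunctionSpaces.IsTestFunctionOn (⊤ : Opens (EuclideanSpace ℝ (Fin 3))) φ →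
        Tendsto (fun t => ∫ x, ⟪ω' t x, φ x⟫) (𝓝[<] T₁) (𝓝 0))
    (hae : uncurry (vorticity U) =ᵐ[volume.restrict
      (Ioo T₄ T₁ ×ˢ {x : EuclideanSpace ℝ (Fin 3) | R < ⟪x, d⟫})] uncurry ω')
    (hsolU : IsDistributionalNSSolutionOn
      ⟨Ioo T₄ T₁ ×ˢ {x : EuclideanSpace ℝ (Fin 3) | R < ⟪x, d⟫},
        isOpen_Ioo.prod (isOpen_lt continuous_const (continuous_id.inner continuous_const))⟩ ν 0 U p)
    (hCD : ∀ w ∈ Ioo T₄ T₁ ×ˢ {x : EuclideanSpace ℝ (Fin 3) | R < ⟪x, d⟫},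
      ContDiffAt ℝ (⊤ : ℕ∞) (U w.1) w.2)
    (hjc : ∀ n ≤ 4, ContinuousOn
      (fun w : ℝ × EuclideanSpace ℝ (Fin 3) => iteratedFDeriv ℝ n (U w.1) w.2)
      (Ioo T₄ T₁ ×ˢ {x : EuclideanSpace ℝ (Fin 3) | R < ⟪x, d⟫}))
    (hbdK : ∀ n ≤ 3, ∀ w ∈ Ioo T₄ T₁ ×ˢ {x : EuclideanSpace ℝ (Fin 3) | R < ⟪x, d⟫},
      ‖iteratedFDeriv ℝ n (U w.1) w.2‖ ≤ K) :
    ∀ t ∈ Ioo T₄ T₁, ∀ x : EuclideanSpace ℝ (Fin 3), R + Real.sqrt (ν * (T₁ - T₄)) < ⟪x, d⟫ →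
      curl (U t) x = 0 := by
  set S : Set (EuclideanSpace ℝ (Fin 3)) := {x : EuclideanSpace ℝ (Fin 3) | R < ⟪x, d⟫}
    with hSdef
  have hSo : IsOpen S := isOpen_lt continuous_const (continuous_id.inner continuous_const)
  set Ω : Set (ℝ × EuclideanSpace ℝ (Fin 3)) := Ioo T₄ T₁ ×ˢ S with hΩdef
  have hΩo : IsOpen Ω := isOpen_Ioo.prod hSo
  -- a nonnegative bound
  set K₀ : ℝ := max K 0 with hK₀def
  have hK₀ : 0 ≤ K₀ := le_max_right _ _
  have hbdK' : ∀ n ≤ 3, ∀ w ∈ Ω, ‖iteratedFDeriv ℝ n (U w.1) w.2‖ ≤ K₀ := fun n hn w hw =>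
    (hbdK n hn w hw).trans (le_max_left _ _)
  -- smoothness of the slices on `S`
  have hUS : ∀ t ∈ Ioo T₄ T₁, ContDiffOn ℝ 4 (U t) S := fun t ht x hx =>
    ((hCD (t, x) ⟨ht, hx⟩).of_le (by norm_cast)).contDiffWithinAt
  -- ### the Navier–Stokes rescaling to unit viscosity and the window `]-1, 0[`
  set β : ℝ := T₁ - T₄ with hβdef
  have hβ : 0 < β := sub_pos.2 hT₄
  set γ : ℝ := Real.sqrt (ν * β) with hγdef
  have hγ : 0 < γ := Real.sqrt_pos.2 (mul_pos hν hβ)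
  have hγ0 : γ ≠ 0 := hγ.ne'
  have hγ2 : γ ^ 2 = ν * β := Real.sq_sqrt (mul_pos hν hβ).le
  set α : ℝ := γ / ν with hαdef
  have hα : 0 < α := div_pos hγ hν
  have hαγ : β = α * γ := by
    rw [hαdef, div_mul_eq_mul_div, ← sq, hγ2]
    field_simp
  have hvisc : α * ν / γ = 1 := by
    rw [hαdef]
    field_simp
  have hαγ0 : α * γ ≠ 0 := mul_ne_zero hα.ne' hγ0
  -- the map `Φ`
  set Φ : ℝ × EuclideanSpace ℝ (Fin 3) → ℝ × EuclideanSpace ℝ (Fin 3) :=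
    fun z => (T₁ + β * z.1, γ • z.2) with hΦdef
  have hΦst : stAffine β γ T₁ (0 : EuclideanSpace ℝ (Fin 3)) = Φ := by
    funext z
    simp [stAffine, hΦdef]
  have hΦc : Continuous Φ := by
    rw [hΦdef]
    fun_prop
  -- the rescaled region
  set R' : ℝ := R / γ with hR'def
  set S' : Set (EuclideanSpace ℝ (Fin 3)) := {y : EuclideanSpace ℝ (Fin 3) | R' < ⟪y, d⟫}
    with hS'def
  have hS'o : IsOpen S' := isOpen_lt continuous_const (continuous_id.inner continuous_const)
  set Ω' : Set (ℝ × EuclideanSpace ℝ (Fin 3)) := Ioo (-1 : ℝ) 0 ×ˢ S' with hΩ'def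
  have hΩ'o : IsOpen Ω' := isOpen_Ioo.prod hS'o
  have hpre : Φ ⁻¹' Ω = Ω' := by
    rw [hΦdef, hΩdef, hSdef, hΩ'def, hS'def, hR'def, hβdef]
    have hβ' : 0 < T₁ - T₄ := sub_pos.2 hT₄
    ext ⟨s, y⟩
    simp only [mem_preimage, mem_prod, mem_Ioo, mem_setOf_eq, real_inner_smul_left]
    constructor
    · rintro ⟨⟨h1, h2⟩, h3⟩
      refine ⟨⟨?_, ?_⟩, ?_⟩
      · nlinarith
      · nlinarith
      · rwa [div_lt_iff₀ hγ, mul_comm]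
    · rintro ⟨⟨h1, h2⟩, h3⟩
      refine ⟨⟨?_, ?_⟩, ?_⟩
      · nlinarith
      · nlinarith
      · rw [div_lt_iff₀ hγ, mul_comm] at h3
        exact h3
  have hmaps : MapsTo Φ Ω' Ω := fun z hz => by
    have : z ∈ Φ ⁻¹' Ω := by rw [hpre]; exact hz
    exact this
  have hmaps1 : ∀ z ∈ Ω', T₁ + β * z.1 ∈ Ioo T₄ T₁ := fun z hz => (hmaps hz).1
  have hmaps2 : ∀ z ∈ Ω', γ • z.2 ∈ S := fun z hz => (hmaps hz).2
  have hmapsγ : MapsTo (fun y : EuclideanSpace ℝ (Fin 3) => γ • y) S' S := by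
    intro y hy
    have hy' : R / γ < ⟪y, d⟫ := hy
    rw [div_lt_iff₀ hγ] at hy'
    show R < ⟪γ • y, d⟫
    rw [real_inner_smul_left]
    linarith [mul_comm ⟪y, d⟫ γ]
  -- the rescaled fields
  obtain ⟨U', hU'def⟩ : ∃ U' : ℝ → EuclideanSpace ℝ (Fin 3) → EuclideanSpace ℝ (Fin 3),
      U' = α • stPull β γ T₁ (0 : EuclideanSpace ℝ (Fin 3)) U := ⟨_, rfl⟩
  obtain ⟨w, hwdef⟩ : ∃ w : ℝ → EuclideanSpace ℝ (Fin 3) → EuclideanSpace ℝ (Fin 3),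
      w = (α * γ) • stPull β γ T₁ (0 : EuclideanSpace ℝ (Fin 3)) ω' := ⟨_, rfl⟩
  obtain ⟨π', hπ'def⟩ : ∃ π' : ℝ → EuclideanSpace ℝ (Fin 3) → ℝ,
      π' = α ^ 2 • stPull β γ T₁ (0 : EuclideanSpace ℝ (Fin 3)) p := ⟨_, rfl⟩
  have hU'app : ∀ s y, U' s y = α • U (T₁ + β * s) (γ • y) := fun s y => by
    rw [hU'def]
    simp [smul_stPull_apply]
  have hwapp : ∀ s y, w s y = (α * γ) • ω' (T₁ + β * s) (γ • y) := fun s y => by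
    rw [hwdef]
    simp [smul_stPull_apply]
  -- the linear change of variables `e y = γ y`
  set e : EuclideanSpace ℝ (Fin 3) ≃L[ℝ] EuclideanSpace ℝ (Fin 3) :=
    ContinuousLinearEquiv.equivOfInverse
      (γ • ContinuousLinearMap.id ℝ (EuclideanSpace ℝ (Fin 3)))
      (γ⁻¹ • ContinuousLinearMap.id ℝ (EuclideanSpace ℝ (Fin 3)))
      (fun y => by simp [smul_smul, hγ0]) (fun y => by simp [smul_smul, hγ0]) with hedef
  have he : ∀ y, e y = γ • y := fun y => rfl
  have henorm : ‖(e : EuclideanSpace ℝ (Fin 3) →L[ℝ] EuclideanSpace ℝ (Fin 3))‖ ≤ γ := by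
    refine ContinuousLinearMap.opNorm_le_bound _ hγ.le fun y => ?_
    rw [ContinuousLinearEquiv.coe_coe, he y, norm_smul, Real.norm_of_nonneg hγ.le]
  have hU'fun : ∀ s, U' s = α • (U (T₁ + β * s) ∘ ⇑e) := fun s => by
    funext y
    rw [hU'app]
    rfl
  -- the formula for `D_yⁿ U'(s, ·)` at the points of `Ω'`
  have hformula : ∀ n : ℕ, ∀ z ∈ Ω', iteratedFDeriv ℝ n (U' z.1) z.2 =
      α • (iteratedFDeriv ℝ n (U (T₁ + β * z.1)) (γ • z.2)).compContinuousLinearMap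
        fun _ => (e : EuclideanSpace ℝ (Fin 3) →L[ℝ] EuclideanSpace ℝ (Fin 3)) := by
    intro n z hz
    have hca : ContDiffAt ℝ n (U (T₁ + β * z.1) ∘ ⇑e) z.2 := by
      refine ContDiffAt.comp z.2 ?_ e.contDiff.contDiffAt
      rw [he]
      exact (hCD (T₁ + β * z.1, γ • z.2) ⟨hmaps1 z hz, hmaps2 z hz⟩).of_le
        (by exact_mod_cast le_top)
    rw [hU'fun, iteratedFDeriv_const_smul_apply hca, iteratedFDeriv_slice_comp_continuousLinearEquiv,
      he]
  -- ### (i) the rescaled pair solves the unit-viscosity equations in `𝒟'(Ω')`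
  have hsol' : IsDistributionalNSSolutionOn ⟨Ω', hΩ'o⟩ 1 0 U' π' := by
    have h := hsolU.stRescale hα hγ hαγ T₁ (0 : EuclideanSpace ℝ (Fin 3))
    have e1 : stPreimage β γ T₁ (0 : EuclideanSpace ℝ (Fin 3)) ⟨Ω, hΩo⟩ =
        (⟨Ω', hΩ'o⟩ : Opens (ℝ × EuclideanSpace ℝ (Fin 3))) := by
      refine TopologicalSpace.Opens.ext ?_
      show stAffine β γ T₁ (0 : EuclideanSpace ℝ (Fin 3)) ⁻¹' Ω = Ω'
      rw [hΦst, hpre]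
    have e3 : (α ^ 2 * γ) • stPull β γ T₁ (0 : EuclideanSpace ℝ (Fin 3))
        (0 : ℝ → EuclideanSpace ℝ (Fin 3) → EuclideanSpace ℝ (Fin 3)) = 0 := by
      funext s y
      simp [stPull_apply]
    rw [e1, hvisc, e3, ← hU'def, ← hπ'def] at h
    exact h
  -- ### (ii) the vorticity of `U'` on `Ω'`, and `∇ ∧ U' = w` a.e. on `Ω'`
  have hcurlΩ : ∀ z ∈ Ω', vorticity U' z.1 z.2 = (α * γ) • vorticity U (T₁ + β * z.1) (γ • z.2) := by
    intro z hz
    have hxS : γ • z.2 ∈ S := hmaps2 z hz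
    have ht : T₁ + β * z.1 ∈ Ioo T₄ T₁ := hmaps1 z hz
    have hdU : DifferentiableAt ℝ (U (T₁ + β * z.1)) (γ • z.2) :=
      ((hCD (T₁ + β * z.1, γ • z.2) ⟨ht, hxS⟩).differentiableAt (by simp)).differentiableWithinAt
        |>.differentiableAt (hSo.mem_nhds hxS)
    have hderiv : HasFDerivAt (U' z.1)
        (α • (fderiv ℝ (U (T₁ + β * z.1)) (γ • z.2)).comp
          (γ • ContinuousLinearMap.id ℝ (EuclideanSpace ℝ (Fin 3)))) z.2 := by
      rw [hU'fun]
      have h1 : HasFDerivAt (fun y : EuclideanSpace ℝ (Fin 3) => γ • y)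
          (γ • ContinuousLinearMap.id ℝ (EuclideanSpace ℝ (Fin 3))) z.2 :=
        (hasFDerivAt_id z.2).const_smul γ
      have h2 : HasFDerivAt (U (T₁ + β * z.1)) (fderiv ℝ (U (T₁ + β * z.1)) (γ • z.2)) (γ • z.2) :=
        hdU.hasFDerivAt
      exact (h2.comp z.2 h1).const_smul α
    have hcomp : (fderiv ℝ (U (T₁ + β * z.1)) (γ • z.2)).comp
        (γ • ContinuousLinearMap.id ℝ (EuclideanSpace ℝ (Fin 3))) = γ • fderiv ℝ (U (T₁ + β * z.1)) (γ • z.2) := by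
      ext1 v
      simp
    rw [vorticity_apply, vorticity_apply, curl_eq_curlCLM, curl_eq_curlCLM, hderiv.fderiv, hcomp,
      smul_smul, map_smul]
  have hae' : uncurry (vorticity U') =ᵐ[volume.restrict Ω'] uncurry w := by
    have h0 := ae_eq_restrict_comp_stAffine hβ hγ T₁ (0 : EuclideanSpace ℝ (Fin 3)) hae
    rw [hΦst, hpre] at h0
    have hmem : ∀ᵐ z ∂(volume.restrict Ω'), z ∈ Ω' := ae_restrict_mem hΩ'o.measurableSet
    filter_upwards [h0, hmem] with z hz hzΩ
    have hz' : vorticity U (T₁ + β * z.1) (γ • z.2) = ω' (T₁ + β * z.1) (γ • z.2) := hz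
    show vorticity U' z.1 z.2 = w z.1 z.2
    rw [hcurlΩ z hzΩ, hwapp, hz']
  -- ### (iii) the slices of `w` tend weakly to zero at the top time `s = 0`
  have htop : ∀ φ : EuclideanSpace ℝ (Fin 3) → EuclideanSpace ℝ (Fin 3),
      ContDiff ℝ (⊤ : ℕ∞) φ → HasCompactSupport φ → ∀ ε : ℝ, 0 < ε →
      ∃ s₀ : ℝ, s₀ < 0 ∧ ∀ᵐ s ∂(volume.restrict (Ioo s₀ 0)), |∫ y, ⟪w s y, φ y⟫| ≤ ε := by
    intro φ hφ hφc ε hε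
    -- the dilated test field `ψ = φ(·/γ)`
    set ψ : EuclideanSpace ℝ (Fin 3) → EuclideanSpace ℝ (Fin 3) := fun x => φ (γ⁻¹ • x)
      with hψdef
    have hψ : FunctionSpaces.IsTestFunctionOn (⊤ : Opens (EuclideanSpace ℝ (Fin 3))) ψ :=
      { contDiff := hφ.comp (contDiff_const_smul _)
        hasCompactSupport :=
          hφc.comp_homeomorph (Homeomorph.smulOfNeZero γ⁻¹ (inv_ne_zero hγ0))
        tsupport_subset := fun y _ => Opens.mem_top y }
    have hψγ : ∀ y, ψ (γ • y) = φ y := fun y => by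
      simp only [hψdef, inv_smul_smul₀ hγ0]
    -- the integral identity
    set c : ℝ := |(γ ^ Module.finrank ℝ (EuclideanSpace ℝ (Fin 3)))⁻¹| with hcdef
    have hc : 0 < c := by
      rw [hcdef, abs_pos]
      exact inv_ne_zero (pow_ne_zero _ hγ0)
    have hident : ∀ s, ∫ y, ⟪w s y, φ y⟫ =
        (α * γ) * (c * ∫ x, ⟪ω' (T₁ + β * s) x, ψ x⟫) := by
      intro s
      have h1 : (fun y => ⟪w s y, φ y⟫) =
          fun y => (α * γ) * (fun x => ⟪ω' (T₁ + β * s) x, ψ x⟫) (γ • y) := by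
        funext y
        simp only [hwapp, real_inner_smul_left, hψγ]
      rw [h1, integral_const_mul, Measure.integral_comp_smul volume
        (fun x => ⟪ω' (T₁ + β * s) x, ψ x⟫) γ, smul_eq_mul]
    -- the limit
    have hlim := hfinal ψ hψ
    rw [Metric.tendsto_nhdsWithin_nhds] at hlim
    have hαγpos : 0 < α * γ := mul_pos hα hγ
    have hε' : 0 < ε / (α * γ * c) := div_pos hε (mul_pos hαγpos hc)
    obtain ⟨δ, hδ, hδε⟩ := hlim (ε / (α * γ * c)) hε'
    refine ⟨-(δ / β), by rw [neg_lt_zero]; exact div_pos hδ hβ, ?_⟩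
    refine (ae_restrict_iff' measurableSet_Ioo).2 (ae_of_all _ fun s hs => ?_)
    have hs1 : T₁ + β * s ∈ Iio T₁ := by
      show T₁ + β * s < T₁
      nlinarith [hs.2]
    have hs2 : dist (T₁ + β * s) T₁ < δ := by
      rw [Real.dist_eq, add_sub_cancel_left, abs_mul, abs_of_pos hβ, abs_of_neg hs.2]
      have h : -s < δ / β := by linarith [hs.1]
      have h' : -s * β < δ := (lt_div_iff₀ hβ).1 h
      linarith [mul_comm (-s) β]
    have h3 := hδε hs1 hs2
    rw [Real.dist_eq, sub_zero] at h3
    rw [hident, abs_mul, abs_mul, abs_of_pos hα, abs_of_pos hγ, abs_mul, abs_of_pos hc]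
    have h4 : α * γ * (c * |∫ x, ⟪ω' (T₁ + β * s) x, ψ x⟫|) ≤ α * γ * (c * (ε / (α * γ * c))) := by
      gcongr
    refine h4.trans (le_of_eq ?_)
    field_simp
  -- ### (iv) regularity of the rescaled field
  have hU4' : ∀ s ∈ Ioo (-1 : ℝ) 0, ContDiffOn ℝ 4 (U' s) S' := by
    intro s hs
    have ht : T₁ + β * s ∈ Ioo T₄ T₁ := by
      refine ⟨?_, by nlinarith [hs.2, hβ]⟩
      rw [hβdef]
      nlinarith [hs.1, hβ, hβdef]
    rw [hU'fun]
    exact ((hUS _ ht).comp e.contDiff.contDiffOn (fun y hy => hmapsγ hy)).const_smul α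
  have hΦ' : ∀ n ≤ 4, ContinuousOn
      (fun z : ℝ × EuclideanSpace ℝ (Fin 3) => iteratedFDeriv ℝ n (U' z.1) z.2) Ω' := by
    intro n hn
    have hg : ContinuousOn (fun z : ℝ × EuclideanSpace ℝ (Fin 3) =>
        α • (iteratedFDeriv ℝ n (U (T₁ + β * z.1)) (γ • z.2)).compContinuousLinearMap
          fun _ => (e : EuclideanSpace ℝ (Fin 3) →L[ℝ] EuclideanSpace ℝ (Fin 3))) Ω' := by
      have h1 : ContinuousOn (fun z : ℝ × EuclideanSpace ℝ (Fin 3) =>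
          iteratedFDeriv ℝ n (U (T₁ + β * z.1)) (γ • z.2)) Ω' :=
        (hjc n hn).comp hΦc.continuousOn hmaps
      exact ((ContinuousMultilinearMap.continuous_precomp
        (fun _ : Fin n => (e : EuclideanSpace ℝ (Fin 3) →L[ℝ] EuclideanSpace ℝ (Fin 3)))
          ).comp_continuousOn h1).const_smul α
    exact hg.congr fun z hz => hformula n z hz
  -- the uniform bound `K' = α K₀ G³`, `G = max 1 γ`
  set G : ℝ := max 1 γ with hGdef
  have hG1 : 1 ≤ G := le_max_left _ _
  have hγG : γ ≤ G := le_max_right _ _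
  set K' : ℝ := α * K₀ * G ^ 3 with hK'def
  have hK'bd : ∀ n ≤ 3, ∀ z ∈ Ω', ‖iteratedFDeriv ℝ n (U' z.1) z.2‖ ≤ K' := by
    intro n hn z hz
    rw [hformula n z hz, norm_smul, Real.norm_of_nonneg hα.le]
    have h1 : ‖(iteratedFDeriv ℝ n (U (T₁ + β * z.1)) (γ • z.2)).compContinuousLinearMap
        fun _ => (e : EuclideanSpace ℝ (Fin 3) →L[ℝ] EuclideanSpace ℝ (Fin 3))‖ ≤ K₀ * G ^ 3 := by
      refine (ContinuousMultilinearMap.norm_compContinuousLinearMap_le _ _).trans ?_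
      rw [Finset.prod_const, Finset.card_univ, Fintype.card_fin]
      have h2 : ‖iteratedFDeriv ℝ n (U (T₁ + β * z.1)) (γ • z.2)‖ ≤ K₀ :=
        hbdK' n hn (T₁ + β * z.1, γ • z.2) ⟨hmaps1 z hz, hmaps2 z hz⟩
      have h3 : ‖(e : EuclideanSpace ℝ (Fin 3) →L[ℝ] EuclideanSpace ℝ (Fin 3))‖ ^ n ≤ G ^ 3 :=
        calc ‖(e : EuclideanSpace ℝ (Fin 3) →L[ℝ] EuclideanSpace ℝ (Fin 3))‖ ^ n ≤ G ^ n :=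
              pow_le_pow_left₀ (norm_nonneg _) (henorm.trans hγG) n
          _ ≤ G ^ 3 := pow_le_pow_right₀ hG1 hn
      exact mul_le_mul h2 h3 (pow_nonneg (norm_nonneg _) _) hK₀
    calc α * ‖(iteratedFDeriv ℝ n (U (T₁ + β * z.1)) (γ • z.2)).compContinuousLinearMap
          fun _ => (e : EuclideanSpace ℝ (Fin 3) →L[ℝ] EuclideanSpace ℝ (Fin 3))‖
        ≤ α * (K₀ * G ^ 3) := mul_le_mul_of_nonneg_left h1 hα.le
      _ = K' := by rw [hK'def]; ring
  -- ### (v) backward uniqueness in the class `C¹ ∩ {∂ₓω ∈ C¹}`: `curl U' = 0` beyond `R' + 1`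
  have hzero : ∀ z ∈ Ioo (-1 : ℝ) 0 ×ˢ {y : EuclideanSpace ℝ (Fin 3) | R' + 1 < ⟪y, d⟫},
      curl (U' z.1) z.2 = 0 :=
    farField_curl_eq_zero_halfSpace_of_vorticity_top hd htop hae' hsol' hU4' hΦ' hK'bd
  -- ### (vi) back to `U`: `curl U(t, ·) = 0` on `{⟪x, d⟫ > R + γ}`
  intro t ht x hxn
  have hxS : x ∈ S := by
    show R < ⟪x, d⟫
    linarith [hγ.le]
  -- the rescaled point `(s, y)`
  set s : ℝ := (t - T₁) / β with hsdef
  have hts : T₁ + β * s = t := by rw [hsdef]; field_simp; ring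
  have hs : s ∈ Ioo (-1 : ℝ) 0 := by
    rw [hsdef]
    constructor
    · rw [lt_div_iff₀ hβ]; rw [hβdef]; linarith [ht.1]
    · rw [div_lt_iff₀ hβ]; linarith [ht.2]
  set y : EuclideanSpace ℝ (Fin 3) := γ⁻¹ • x with hydef
  have hyx : γ • y = x := by rw [hydef, smul_inv_smul₀ hγ0]
  have hy : R' + 1 < ⟪y, d⟫ := by
    rw [hydef, real_inner_smul_left, hR'def]
    have h1 : R / γ + 1 = (R + γ) / γ := by field_simp
    rw [h1, inv_mul_eq_div, div_lt_div_iff_of_pos_right hγ]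
    exact hxn
  have h0 := hzero (s, y) ⟨hs, hy⟩
  simp only at h0
  -- `curl U'(s, ·)(y) = αγ • curl U(t, ·)(x)`
  have hdU : DifferentiableAt ℝ (U t) x :=
    ((hCD (t, x) ⟨ht, hxS⟩).differentiableAt (by simp)).differentiableWithinAt.differentiableAt
      (hSo.mem_nhds hxS)
  have hderiv : HasFDerivAt (U' s)
      (α • (fderiv ℝ (U t) x).comp
        (γ • ContinuousLinearMap.id ℝ (EuclideanSpace ℝ (Fin 3)))) y := by
    rw [hU'fun, hts]
    have h1 : HasFDerivAt (fun y : EuclideanSpace ℝ (Fin 3) => γ • y)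
        (γ • ContinuousLinearMap.id ℝ (EuclideanSpace ℝ (Fin 3))) y :=
      (hasFDerivAt_id y).const_smul γ
    have h2 : HasFDerivAt (U t) (fderiv ℝ (U t) x) (γ • y) := by
      rw [hyx]; exact hdU.hasFDerivAt
    exact (h2.comp y h1).const_smul α
  have hcomp : (fderiv ℝ (U t) x).comp (γ • ContinuousLinearMap.id ℝ (EuclideanSpace ℝ (Fin 3)))
      = γ • fderiv ℝ (U t) x := by
    ext1 v
    simp
  have hcurl : curl (U' s) y = (α * γ) • curl (U t) x := by
    rw [curl_eq_curlCLM, curl_eq_curlCLM, hderiv.fderiv, hcomp, smul_smul, map_smul]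
  rw [hcurl] at h0
  exact (smul_eq_zero.1 h0).resolve_left hαγ0

end Literature.Analysis.FluidPDE

end
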